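import Literature.Analysis.FluidPDE.PassiveVectorTensorClass
import HarnessLib

/-!
# Translation covariance of weak TENSOR-viscosity passive-vector solutions on `T^d`

Analysis/FluidPDE proof-support file (everything proved; no new definitions, no named facts).  The weak class
`Torus.IsWeakTensorPassiveVectorOn A T 𝔸 b w₀ w` of `PassiveVectorTensor.lean` (Frisch's anisotropic-eddy-viscosity
passive-vector equation (9.57), `∂ₜw + (b·∇)w + A (w·∇)b + ∇π = 𝓛_𝔸 w`, `∇·w = 0`, constant tensor `𝔸`, weak form of
DiPerna–Lions 1989 §II.1) is COVARIANT UNDER SPATIAL TRANSLATIONS of the flat torus: if `w` is a weak solution along the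
carrier `b` from the datum `w₀`, then `(t, x) ↦ w t (x + a)` is a weak solution along `(t, x) ↦ b t (x + a)` from
`x ↦ w₀ (x + a)` (`IsWeakTensorPassiveVectorOn.translate`).  The constant tensor commutes with translations, the Haar
measure of `T^d` is translation invariant, and the test class is translation invariant; the proof transports every
bookkeeping clause and tests the original identity against the back-translated test field.

§1 is the (definition-chasing) calculus of translates on `T^d`: `liftAt`, `Torus.fderiv`, `lineDeriv`, `partialDeriv`,
`gradient`, `divergence`, `laplacian`, `convect`, `viscAdj`, `timeDeriv`, `stLift`, `IsDivFree`, `IsWeaklyDivFree`,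
`IsSpaceTimeTest` of `x ↦ f (x + a)`.

Consumer (cell `ad-ideate`, route `SolenoidalFractalHomogenisation`, K1L stubs `stub_cellEnergyT` / `stub_cellLawV` /
`stub_oneLevelL`, stmt-AnomalousDissipation-24912): along a `(1/n)`-PERIODIC carrier (the cell field of a lattice word)
the translates by `h ∈ (n⁻¹ℤ)^d` of a weak solution are weak solutions along the SAME carrier, so the real character
averages `n^{-d} Σ_h 2cos(2π ℓ·h) w(·, · + h)` (the Bloch-sector projections) are weak solutions
(`PassiveVectorTensorSuperposition`); with uniqueness (`PassiveVectorTensorUniqueness.ae_eq_of_memLp_top`) this gives the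
sector preservation of EVERY weak solution without a Galerkin construction.

## Mathlib / tree search

Tree: `FlatTorus` (`liftAt`, `proj_add`, `proj_repr`, `IsSmooth.comp_add_right`), `TorusCalculus` (all derivatives are
derivatives of `liftAt f x` at `0` or of `t ↦ f (x + proj (t • v))` at `0`), `TorusTestFunction` (`IsSpaceTimeTest`,
`IsWeaklyDivFree`), `PassiveVectorTensorClass` (class API).  Mathlib: `measurePreserving_add_right`,
`lintegral_add_right_eq_self`, `integral_add_right_eq_self`, `MeasurePreserving.prod`, `MeasurePreserving.restrict_preimage`,
`AEStronglyMeasurable.comp_measurePreserving`.  No translation lemma for either weak passive-vector class existed (2026-08-28).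

## References

* R. J. DiPerna, P.-L. Lions, Invent. Math. 98 (1989) 511–547, §II.1 (12)–(14). [`DiPernaLions1989`]
* U. Frisch, *Turbulence* (CUP 1995), §9.6.3 eq. (9.57) p. 233. [`Frisch1995Turbulence`]
* A. Bensoussan, J.-L. Lions, G. Papanicolaou, *Asymptotic Analysis for Periodic Structures* (1978), Ch. 4 §3
  (Bloch waves) — context for the consumer only.
-/

noncomputable section

open MeasureTheory TopologicalSpace Set Function Filter Topology UnitAddTorus
open scoped ENNReal NNReal InnerProductSpace

/-! ## §1 Calculus of translates on the flat torus -/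

namespace Literature.Analysis.FunctionSpaces.Torus

/-- The re-centred lift of a translate: `liftAt (f(· + a)) x = liftAt f (x + a)` (the chart of `TorusCalculus` at `x` for the
translate is the chart at `x + a`; translation `τ^a` on `T^d`). [cite: Grafakos2014, §3.1 (translation on the torus)] -/
theorem liftAt_translate {d F : Type*} (f : UnitAddTorus d → F) (a x : UnitAddTorus d) :
    liftAt (fun y => f (y + a)) x = liftAt f (x + a) := by
  funext v
  simp only [liftAt_apply, add_right_comm]

/-- `Torus.fderiv (f(· + a)) x = Torus.fderiv f (x + a)`: derivatives commute with translations. [cite: Grafakos2014, §3.1 (translation on the torus)] -/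
theorem fderiv_translate {d : Type*} [Fintype d] {F : Type*} [NormedAddCommGroup F] [NormedSpace ℝ F]
    (f : UnitAddTorus d → F) (a x : UnitAddTorus d) :
    Torus.fderiv (fun y => f (y + a)) x = Torus.fderiv f (x + a) := by
  unfold Torus.fderiv
  rw [liftAt_translate]

/-- `lineDeriv (f(· + a)) x v = lineDeriv f (x + a) v`. [cite: Grafakos2014, §3.1 (translation on the torus)] -/
theorem lineDeriv_translate {d : Type*} {F : Type*} [NormedAddCommGroup F] [NormedSpace ℝ F]
    (f : UnitAddTorus d → F) (a x : UnitAddTorus d) (v : EuclideanSpace ℝ d) :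
    lineDeriv (fun y => f (y + a)) x v = lineDeriv f (x + a) v := by
  unfold lineDeriv
  simp only [add_right_comm]

/-- `∂ᵢ (f(· + a)) x = ∂ᵢ f (x + a)`. [cite: Grafakos2014, §3.1 (translation on the torus)] -/
theorem partialDeriv_translate {d : Type*} [Fintype d] [DecidableEq d] {F : Type*} [NormedAddCommGroup F] [NormedSpace ℝ F]
    (i : d) (f : UnitAddTorus d → F) (a x : UnitAddTorus d) :
    partialDeriv i (fun y => f (y + a)) x = partialDeriv i f (x + a) := by
  unfold partialDeriv
  exact lineDeriv_translate f a x _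

/-- `∂ᵢ (f(· + a)) = (∂ᵢ f)(· + a)` as functions. [cite: Grafakos2014, §3.1 (translation on the torus)] -/
theorem partialDeriv_translate' {d : Type*} [Fintype d] [DecidableEq d] {F : Type*} [NormedAddCommGroup F] [NormedSpace ℝ F]
    (i : d) (f : UnitAddTorus d → F) (a : UnitAddTorus d) :
    partialDeriv i (fun y => f (y + a)) = fun x => partialDeriv i f (x + a) :=
  funext (partialDeriv_translate i f a)

/-- `∇(θ(· + a)) x = ∇θ (x + a)`. [cite: Grafakos2014, §3.1 (translation on the torus)] -/
theorem gradient_translate {d : Type*} [Fintype d] (θ : UnitAddTorus d → ℝ) (a x : UnitAddTorus d) :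
    gradient (fun y => θ (y + a)) x = gradient θ (x + a) := by
  unfold gradient
  rw [liftAt_translate]

/-- `div (u(· + a)) x = div u (x + a)`. [cite: Grafakos2014, §3.1 (translation on the torus)] -/
theorem divergence_translate {d : Type*} [Fintype d] [DecidableEq d] (u : UnitAddTorus d → EuclideanSpace ℝ d)
    (a x : UnitAddTorus d) :
    divergence (fun y => u (y + a)) x = divergence u (x + a) := by
  unfold divergence
  refine Finset.sum_congr rfl fun i _ => ?_
  exact partialDeriv_translate i (fun y => u y i) a x

/-- `Δ(f(· + a)) x = Δ f (x + a)`. [cite: Grafakos2014, §3.1 (translation on the torus)] -/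
theorem laplacian_translate {d : Type*} [Fintype d] {F : Type*} [NormedAddCommGroup F] [NormedSpace ℝ F]
    (f : UnitAddTorus d → F) (a x : UnitAddTorus d) :
    laplacian (fun y => f (y + a)) x = laplacian f (x + a) := by
  unfold laplacian
  rw [liftAt_translate]

/-- `((u·∇)(v(· + a)))(x) = Dv(x + a)[u(x)]`, i.e. `convect u (v(· + a)) x = Torus.fderiv v (x + a) (u x)`.
[cite: Grafakos2014, §3.1 (translation on the torus)] -/
theorem convect_translate {d : Type*} [Fintype d] {F : Type*} [NormedAddCommGroup F] [NormedSpace ℝ F]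
    (u : UnitAddTorus d → EuclideanSpace ℝ d) (v : UnitAddTorus d → F) (a x : UnitAddTorus d) :
    convect u (fun y => v (y + a)) x = Torus.fderiv v (x + a) (u x) := by
  unfold convect
  rw [fderiv_translate]

/-- Translates of divergence-free fields are divergence free. [cite: Temam1984, Ch. I §1.4 (the space H)] -/
theorem IsDivFree.translate {d : Type*} [Fintype d] [DecidableEq d] {u : UnitAddTorus d → EuclideanSpace ℝ d}
    (hu : IsDivFree u) (a : UnitAddTorus d) : IsDivFree (fun y => u (y + a)) := fun x => by
  rw [divergence_translate]
  exact hu _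

/-- Translates of weakly divergence-free fields are weakly divergence free (translation invariance of the Haar
measure; the test gradient is back-translated). [cite: Temam1984, Ch. I §1.4 (the space H)] -/
theorem IsWeaklyDivFree.translate {d : Type*} [Fintype d] {u : UnitAddTorus d → EuclideanSpace ℝ d}
    (hu : IsWeaklyDivFree u) (a : UnitAddTorus d) : IsWeaklyDivFree (fun y => u (y + a)) := by
  intro θ hθ
  have hθ' : IsSmooth (fun y => θ (y + -a)) := hθ.comp_add_right (-a)
  have h := hu _ hθ'
  rw [← integral_add_right_eq_self _ a] at h
  simpa only [gradient_translate, add_neg_cancel_right] using h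

/-- `∂ₜ` commutes with spatial translation. [cite: Grafakos2014, §3.1 (translation on the torus)] -/
theorem timeDeriv_translate {d F : Type*} [NormedAddCommGroup F] [NormedSpace ℝ F] (u : ℝ → UnitAddTorus d → F)
    (a : UnitAddTorus d) (t : ℝ) (x : UnitAddTorus d) :
    timeDeriv (fun s y => u s (y + a)) t x = timeDeriv u t (x + a) := rfl

/-- The space–time lift of a translate: `stLift (u(·, · + a)) = stLift u ∘ ((t, y) ↦ (t, y + repr a))`.
[cite: Grafakos2014, §3.1 (translation on the torus)] -/
theorem stLift_translate {d : Type*} [Fintype d] {F : Type*} (u : ℝ → UnitAddTorus d → F) (a : UnitAddTorus d) :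
    stLift (fun s y => u s (y + a)) = stLift u ∘ fun p : ℝ × EuclideanSpace ℝ d => (p.1, p.2 + repr a) := by
  funext p
  simp only [Function.comp_apply, stLift, proj_add, proj_repr]

/-- Translates of space–time test fields are space–time test fields. [cite: Temam1984, Ch. III §1.1 (test functions of the weak formulation)] -/
theorem IsSpaceTimeTest.translate {d : Type*} [Fintype d] {F : Type*} [NormedAddCommGroup F] [NormedSpace ℝ F]
    {T : ℝ} {ψ : ℝ → UnitAddTorus d → F} (hψ : IsSpaceTimeTest T ψ) (a : UnitAddTorus d) :
    IsSpaceTimeTest T (fun s y => ψ s (y + a)) := by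
  refine ⟨?_, ?_⟩
  · rw [stLift_translate]
    exact hψ.1.comp (contDiff_fst.prodMk (contDiff_snd.add contDiff_const))
  · obtain ⟨T', hT', hz⟩ := hψ.2
    refine ⟨T', hT', fun t ht => ?_⟩
    funext y
    simp only [hz t ht, Pi.zero_apply]

/-- The translation `(t, y) ↦ (t, y + c)` of space–time preserves Lebesgue measure restricted to any slab
`S ×ˢ univ` (translation invariance of Lebesgue measure). [cite: Grafakos2014, §3.1 (translation on the torus)] -/
theorem measurePreserving_prod_add_right {d : Type*} [Fintype d] {S : Set ℝ} (hS : MeasurableSet S)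
    (c : EuclideanSpace ℝ d) :
    MeasurePreserving (fun p : ℝ × EuclideanSpace ℝ d => (p.1, p.2 + c))
      ((volume : Measure (ℝ × EuclideanSpace ℝ d)).restrict (S ×ˢ univ))
      ((volume : Measure (ℝ × EuclideanSpace ℝ d)).restrict (S ×ˢ univ)) := by
  have h1 : MeasurePreserving (fun p : ℝ × EuclideanSpace ℝ d => (p.1, p.2 + c))
      (volume : Measure (ℝ × EuclideanSpace ℝ d)) volume :=
    (MeasurePreserving.id (volume : Measure ℝ)).prod (measurePreserving_add_right volume c)
  have hpre : (fun p : ℝ × EuclideanSpace ℝ d => (p.1, p.2 + c)) ⁻¹' (S ×ˢ (univ : Set (EuclideanSpace ℝ d))) =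
      S ×ˢ univ := by
    ext p
    simp
  have h2 := h1.restrict_preimage (hS.prod MeasurableSet.univ)
  rwa [hpre] at h2

end Literature.Analysis.FunctionSpaces.Torus

/-! ## §2 Translation covariance of the weak tensor class -/

namespace Literature.Analysis.FluidPDE

namespace Torus

variable {d : Type*} [Fintype d] [DecidableEq d]

/-- `𝓛_𝔸^*` commutes with translations (constant tensor): `viscAdj 𝔸 (Ψ(· + a)) x = viscAdj 𝔸 Ψ (x + a)`.
[cite: Frisch1995Turbulence, §9.6.3 eq. (9.57) p. 233] -/
theorem viscAdj_translate (𝔸 : Visc4 d) (Ψ : UnitAddTorus d → EuclideanSpace ℝ d) (a x : UnitAddTorus d) :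
    viscAdj 𝔸 (fun y => Ψ (y + a)) x = viscAdj 𝔸 Ψ (x + a) := by
  simp only [viscAdj, FunctionSpaces.Torus.partialDeriv_translate', FunctionSpaces.Torus.partialDeriv_translate]

namespace IsWeakTensorPassiveVectorOn

variable {A T : ℝ} {𝔸 : Visc4 d} {b w : ℝ → UnitAddTorus d → EuclideanSpace ℝ d}
  {w₀ : UnitAddTorus d → EuclideanSpace ℝ d}

/-- **Translation covariance of weak tensor-viscosity passive-vector solutions.**  If `w` is a weak solution of
`∂ₜw + (b·∇)w + A (w·∇)b + ∇π = 𝓛_𝔸 w`, `∇·w = 0` on `T^d × [0,T)` along `b` from `w₀`, then for every `a ∈ T^d`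
the translate `(t, x) ↦ w t (x + a)` is a weak solution along `(t, x) ↦ b t (x + a)` from `x ↦ w₀ (x + a)`:
the Haar measure of `T^d` is translation invariant, the constant tensor and every differential operator of the weak
formulation commute with translations, and the class of space–time test fields is translation invariant (test the
original identity against `Ψ(·, · − a)`). [cite: DiPernaLions1989, §II.1 (12)–(14)] -/
theorem translate (h : IsWeakTensorPassiveVectorOn A T 𝔸 b w₀ w) (a : UnitAddTorus d) :
    IsWeakTensorPassiveVectorOn A T 𝔸 (fun t x => b t (x + a)) (fun x => w₀ (x + a)) (fun t x => w t (x + a)) where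
  aestronglyMeasurable := by
    rw [FunctionSpaces.Torus.stLift_translate]
    exact h.aestronglyMeasurable.comp_measurePreserving
      (FunctionSpaces.Torus.measurePreserving_prod_add_right measurableSet_Ioo _)
  aestronglyMeasurable_carrier := by
    rw [FunctionSpaces.Torus.stLift_translate]
    exact h.aestronglyMeasurable_carrier.comp_measurePreserving
      (FunctionSpaces.Torus.measurePreserving_prod_add_right measurableSet_Ioo _)
  ae_lintegral_sq_le := by
    obtain ⟨C, hC⟩ := h.ae_lintegral_sq_le
    refine ⟨C, ?_⟩
    filter_upwards [hC] with t ht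
    rwa [lintegral_add_right_eq_self (μ := (volume : Measure (UnitAddTorus d))) (fun x => ‖w t x‖ₑ ^ 2) a]
  lintegral_carrier_lt_top := by
    have e : ∀ t, ∫⁻ x, ‖b t (x + a)‖ₑ ^ 2 = ∫⁻ x, ‖b t x‖ₑ ^ 2 := fun t =>
      lintegral_add_right_eq_self (μ := (volume : Measure (UnitAddTorus d))) (fun x => ‖b t x‖ₑ ^ 2) a
    simp_rw [e]
    exact h.lintegral_carrier_lt_top
  lintegral_mul_lt_top := by
    have e : ∀ t, ∫⁻ x, ‖b t (x + a)‖ₑ * ‖w t (x + a)‖ₑ = ∫⁻ x, ‖b t x‖ₑ * ‖w t x‖ₑ := fun t =>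
      lintegral_add_right_eq_self (μ := (volume : Measure (UnitAddTorus d))) (fun x => ‖b t x‖ₑ * ‖w t x‖ₑ) a
    simp_rw [e]
    exact h.lintegral_mul_lt_top
  ae_isWeaklyDivFree_carrier := by
    filter_upwards [h.ae_isWeaklyDivFree_carrier] with t ht
    exact ht.translate a
  ae_isWeaklyDivFree := by
    filter_upwards [h.ae_isWeaklyDivFree] with t ht
    exact ht.translate a
  weak_eq Ψ hΨ hΨdiv := by
    -- test the original identity against the back-translated field `Ψ' t x = Ψ t (x - a)`
    set Ψ' : ℝ → UnitAddTorus d → EuclideanSpace ℝ d := fun t x => Ψ t (x + -a) with hΨ'_def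
    have hΨ' : FunctionSpaces.Torus.IsSpaceTimeTest T Ψ' := hΨ.translate (-a)
    have hΨ'div : ∀ t, FunctionSpaces.Torus.IsDivFree (Ψ' t) := fun t => (hΨdiv t).translate (-a)
    have key := h.weak_eq Ψ' hΨ' hΨ'div
    -- translate every space integral by `a`
    have hsp : ∀ t, (∫ x, (⟪w t x, FunctionSpaces.Torus.timeDeriv Ψ' t x +
          FunctionSpaces.Torus.convect (b t) (Ψ' t) x + viscAdj 𝔸 (Ψ' t) x⟫_ℝ +
        A * ⟪b t x, FunctionSpaces.Torus.convect (w t) (Ψ' t) x⟫_ℝ)) =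
        ∫ x, (⟪w t (x + a), FunctionSpaces.Torus.timeDeriv Ψ t x +
          FunctionSpaces.Torus.convect (fun y => b t (y + a)) (Ψ t) x + viscAdj 𝔸 (Ψ t) x⟫_ℝ +
        A * ⟪b t (x + a), FunctionSpaces.Torus.convect (fun y => w t (y + a)) (Ψ t) x⟫_ℝ) := by
      intro t
      rw [← integral_add_right_eq_self _ a]
      refine integral_congr_ae (Eventually.of_forall fun x => ?_)
      have e1 : FunctionSpaces.Torus.timeDeriv Ψ' t (x + a) = FunctionSpaces.Torus.timeDeriv Ψ t x := by
        rw [hΨ'_def, FunctionSpaces.Torus.timeDeriv_translate, add_neg_cancel_right]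
      have e2 : FunctionSpaces.Torus.convect (b t) (Ψ' t) (x + a) =
          FunctionSpaces.Torus.convect (fun y => b t (y + a)) (Ψ t) x := by
        simp only [hΨ'_def, FunctionSpaces.Torus.convect]
        rw [FunctionSpaces.Torus.fderiv_translate, add_neg_cancel_right]
      have e3 : viscAdj 𝔸 (Ψ' t) (x + a) = viscAdj 𝔸 (Ψ t) x := by
        rw [hΨ'_def, viscAdj_translate, add_neg_cancel_right]
      have e4 : FunctionSpaces.Torus.convect (w t) (Ψ' t) (x + a) =
          FunctionSpaces.Torus.convect (fun y => w t (y + a)) (Ψ t) x := by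
        simp only [hΨ'_def, FunctionSpaces.Torus.convect]
        rw [FunctionSpaces.Torus.fderiv_translate, add_neg_cancel_right]
      simp only [e1, e2, e3, e4]
    have hd : ∫ x, ⟪w₀ x, Ψ' 0 x⟫_ℝ = ∫ x, ⟪w₀ (x + a), Ψ 0 x⟫_ℝ := by
      rw [← integral_add_right_eq_self _ a]
      refine integral_congr_ae (Eventually.of_forall fun x => ?_)
      simp only [hΨ'_def, add_neg_cancel_right]
    simp_rw [hsp] at key
    rw [hd] at key
    exact key

end IsWeakTensorPassiveVectorOn

end Torus

end Literature.Analysis.FluidPDE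

end
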